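import Summits.BirchSwinnertonDyer.BirchSwinnertonDyer.Theorems.KolyvaginRoadThreePTPairCountingAt
import Summits.BirchSwinnertonDyer.BirchSwinnertonDyer.Theorems.KolyvaginRoadThreeZhangSupplyJumpAdapter
import HarnessLib

/-!
# Route `KolyvaginRoadThree`, deciding crux `ZhangSharpFrameAtThreeHL` (item stmt-BirchSwinnertonDyer-19574):
# PT road, step (R) part 3 — the unsigned jump (J) and the binder `hjump` at `(n, ℓ, T)` with the Selmer-complement
# hypothesis asked FOR THE ONE PAIR `𝓕 ≤ 𝓖` (cell `bsd-stepL`, ACCEL seat `bsd-stepL-koly3b` g10;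
# `--supports stmt-BirchSwinnertonDyer-19574`, helper)

HONEST FRAMING. Theorems only; 0 definitions, 0 named facts, 0 `sorry`; CONDITIONAL on the displayed hypotheses;
nothing at `p = 3` is asserted by the general statements; closes nothing (T7). PARTITION: O2@3 (B10) × A1 × crux 19574 ×
stub PT's consumer chain — proves-glue.

WHAT. Twins of koly3b parts XI (`card_selmerGroup_mul_eq_of_relax`, `relIndex_sq_eq_of_selfdual`,
`exists_forall_sub_zsmul_not_mem_ker_localization`), XII (`exists_forall_sub_zsmul_not_mem_ker_localization_of_lagrangian`)
and XIV (`hjump_of_lagrangian`) in which the ∀-MODULE property `inv.SelmerComplement` (the conjunct of the named fact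
`poitouTate_selmerStructure_duality K` that the owner's PT road does NOT prove for all modules) is replaced by the ONE
instance the proofs use: inclusion (ii) of Howard's Thm. 2.1.11 for the pair `𝓕 ≤ 𝓖` at hand at `S = S(T)` (hypothesis
`hii`, consumed by part 2's `PTAt.card_selmerGroup_pair_at`). Proof bodies are the originals' with the one call re-keyed;
the admissibility hypothesis `hS` on `T` (used there only to invoke the ∀-module fact) disappears from §1–§4.
Part 4 (`hjump_of_localLagrangians` re-derived) supplies `hii` for the constructed pair on `E[3]` from Milne I 4.10(b) for
`E[3]` alone via part 1 (`PTAt.selmerComplementAt_canonical_of_middleExact`).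

References: [cite: McCallumLMS1991, Prop. 2.1 (p. 296)] [cite: WZhang2014, Lemma 8.2] [cite: MilneADT2006, Ch. I,
Thm. 4.10] [cite: Howard2004HeegnerKolyvagin, Thm. 2.1.11] [cite: MazurRubin2004, Prop. 2.3.5].
-/

noncomputable section

open scoped Classical NumberField
open Function NumberField IsDedekindDomain
open Literature.NumberTheory.EllipticCurves
open Literature.NumberTheory.GaloisRepresentations Literature.NumberTheory.GaloisRepresentations.DiscreteGaloisModule
  Literature.NumberTheory.GaloisCohomology
open Summit.BirchSwinnertonDyer.Rank1Residual.X11b.FiniteDuality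
open Summit.BirchSwinnertonDyer.Rank1Residual.GaloisImage
open Summit.BirchSwinnertonDyer.Rank1Residual.X11b.LocBridge
open Summit.BirchSwinnertonDyer.Rank1Residual.X11b.Relaxation
open Summit.BirchSwinnertonDyer.Rank1Residual.X11b.Three.Koly.ZhangSupply

universe u

namespace Summit.BirchSwinnertonDyer.Rank1Residual.X11b.Three.Koly.PTAt

section General

variable {K : Type u} [Field K] [NumberField K] {n : ℕ}
variable {M : Type u} [AddCommGroup M] [TopologicalSpace M] [DiscreteTopology M] [Finite M]
variable {ρ : DiscreteGaloisModule K M} (T : Finset (HeightOneSpectrum (𝓞 K))) (inv : LocalInvariants K n)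

/-! ## §1 The pair count for a relaxation at ONE place -/

/-- **Relaxing at one place: `#H¹_𝓖 · #H¹_{𝓕*} = #H¹_𝓕 · #H¹_{𝓖*} · #H¹(K_w, M)`** for `𝓕 ≤ 𝓖` unramified outside
`S(T)`, equal at every place except `w ∈ T`, where `𝓕_w = 0` and `𝓖_w = H¹(K_w, M)`; `inv` perfect with the Poitou–Tate
vanishing, and Howard's inclusion (ii) for THIS pair at `S(T)` (`hii`). Twin of part XI's `card_selmerGroup_mul_eq_of_relax`.
[cite: MilneADT2006, Ch. I, Thm. 4.10] [cite: MazurRubin2004, Prop. 2.3.5] -/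
theorem card_selmerGroup_mul_eq_of_relax_at [NeZero n] (hperf : inv.IsPerfect) (hsum : inv.SumLocalTermEqZero)
    (hM : ∀ m : M, n • m = 0)
    {𝓕 𝓖 : SelmerStructure ρ} (h𝓕 : 𝓕.IsUnramifiedOutside (finSupport T))
    (h𝓖 : 𝓖.IsUnramifiedOutside (finSupport T)) (w : T)
    (heq : ∀ v : Place K, v ≠ Sum.inr w.1 → 𝓕 v = 𝓖 v)
    (hstrict : 𝓕 (Sum.inr w.1) = ⊥) (hrelax : 𝓖 (Sum.inr w.1) = ⊤)
    (hii : ∀ u : Π v : Place K, galoisCohomology ((ρ.tateDual n).toLocal v) 1,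
      (∀ v ∈ finSupport T, u v ∈ inv.dualSelmerStructure ρ 𝓕 v) →
      (∀ x ∈ 𝓖.selmerGroup,
        ∑ v ∈ finSupport T, localTatePairingZMod ρ n v (inv v)
          (galoisCohomology.localization ρ v 1 x) (u v) = 0) →
      ∃ y ∈ (inv.dualSelmerStructure ρ 𝓕).selmerGroup,
        ∀ v ∈ finSupport T, galoisCohomology.localization (ρ.tateDual n) v 1 y - u v ∈
          inv.dualSelmerStructure ρ 𝓖 v) :
    Nat.card 𝓖.selmerGroup * Nat.card (inv.dualSelmerStructure ρ 𝓕).selmerGroup =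
      Nat.card 𝓕.selmerGroup * Nat.card (inv.dualSelmerStructure ρ 𝓖).selmerGroup *
        Nat.card (galoisCohomology (ρ.toLocal (Sum.inr w.1)) 1) := by
  haveI : ∀ v : HeightOneSpectrum (𝓞 K), Finite (galoisCohomology (ρ.toLocal (Sum.inr v)) 1) :=
    fun v ↦ finite_galoisCohomology_one_toLocal ρ v
  have hle : 𝓕 ≤ 𝓖 := fun v ↦ by
    by_cases hv : v = Sum.inr w.1
    · subst hv; rw [hstrict]; exact bot_le
    · exact (heq v hv).le
  have hinf : ∀ u : InfinitePlace K, 𝓕 (Sum.inl u) = 𝓖 (Sum.inl u) := fun u ↦ heq _ (by simp)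
  have h := card_selmerGroup_pair_at ρ T inv hperf hsum hM hle h𝓕 h𝓖 hinf hii
  -- split the two products at `w`
  have hw : w.1 ∈ T := w.2
  have hF : ∏ v ∈ T, Nat.card (𝓕 (Sum.inr v)) = ∏ v ∈ T.erase w.1, Nat.card (𝓕 (Sum.inr v)) := by
    rw [← Finset.mul_prod_erase T _ hw, hstrict, AddSubgroup.card_bot, one_mul]
  have hG : ∏ v ∈ T, Nat.card (𝓖 (Sum.inr v)) =
      Nat.card (galoisCohomology (ρ.toLocal (Sum.inr w.1)) 1) * ∏ v ∈ T.erase w.1, Nat.card (𝓕 (Sum.inr v)) := by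
    rw [← Finset.mul_prod_erase T _ hw, hrelax, AddSubgroup.card_top]
    congr 1
    refine Finset.prod_congr rfl fun v hv ↦ ?_
    rw [heq (Sum.inr v) (fun h' ↦ Finset.ne_of_mem_erase hv (Sum.inr_injective h'))]
  rw [hF, hG] at h
  have hpos : 0 < ∏ v ∈ T.erase w.1, Nat.card (𝓕 (Sum.inr v)) :=
    Finset.prod_pos fun v _ ↦ Nat.card_pos
  refine Nat.eq_of_mul_eq_mul_right hpos ?_
  calc Nat.card 𝓖.selmerGroup * Nat.card (inv.dualSelmerStructure ρ 𝓕).selmerGroup *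
        ∏ v ∈ T.erase w.1, Nat.card (𝓕 (Sum.inr v))
      = Nat.card 𝓕.selmerGroup * Nat.card (inv.dualSelmerStructure ρ 𝓖).selmerGroup *
          (Nat.card (galoisCohomology (ρ.toLocal (Sum.inr w.1)) 1) *
            ∏ v ∈ T.erase w.1, Nat.card (𝓕 (Sum.inr v))) := h
    _ = _ := by ring

/-! ## §2 Under numeric self-duality the index of the relaxation is EXACTLY `#H¹(K_w, M)^{1/2}` -/

/-- **`[H¹_𝓖 : H¹_𝓕]² = #H¹(K_w, M)`** in the situation of `card_selmerGroup_mul_eq_of_relax_at`, given the numeric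
self-duality `#H¹_{𝓕*} = #H¹_𝓖`, `#H¹_{𝓖*} = #H¹_𝓕`. Twin of part XI's `relIndex_sq_eq_of_selfdual` with Howard's
inclusion (ii) asked for this pair only. [cite: McCallumLMS1991, Prop. 2.1 (p. 296)] [cite: MilneADT2006, Ch. I, Thm. 4.10] -/
theorem relIndex_sq_eq_of_selfdual_at [NeZero n] (hperf : inv.IsPerfect) (hsum : inv.SumLocalTermEqZero)
    (hM : ∀ m : M, n • m = 0)
    {𝓕 𝓖 : SelmerStructure ρ} (h𝓕 : 𝓕.IsUnramifiedOutside (finSupport T))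
    (h𝓖 : 𝓖.IsUnramifiedOutside (finSupport T)) (w : T)
    (heq : ∀ v : Place K, v ≠ Sum.inr w.1 → 𝓕 v = 𝓖 v)
    (hstrict : 𝓕 (Sum.inr w.1) = ⊥) (hrelax : 𝓖 (Sum.inr w.1) = ⊤)
    (hfin : Finite 𝓕.selmerGroup)
    (hFd : Nat.card (inv.dualSelmerStructure ρ 𝓕).selmerGroup = Nat.card 𝓖.selmerGroup)
    (hGd : Nat.card (inv.dualSelmerStructure ρ 𝓖).selmerGroup = Nat.card 𝓕.selmerGroup)
    (hii : ∀ u : Π v : Place K, galoisCohomology ((ρ.tateDual n).toLocal v) 1,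
      (∀ v ∈ finSupport T, u v ∈ inv.dualSelmerStructure ρ 𝓕 v) →
      (∀ x ∈ 𝓖.selmerGroup,
        ∑ v ∈ finSupport T, localTatePairingZMod ρ n v (inv v)
          (galoisCohomology.localization ρ v 1 x) (u v) = 0) →
      ∃ y ∈ (inv.dualSelmerStructure ρ 𝓕).selmerGroup,
        ∀ v ∈ finSupport T, galoisCohomology.localization (ρ.tateDual n) v 1 y - u v ∈
          inv.dualSelmerStructure ρ 𝓖 v) :
    (𝓕.selmerGroup.relIndex 𝓖.selmerGroup) ^ 2 = Nat.card (galoisCohomology (ρ.toLocal (Sum.inr w.1)) 1) := by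
  have hle : 𝓕.selmerGroup ≤ 𝓖.selmerGroup := fun x hx ↦ by
    rw [SelmerStructure.mem_selmerGroup_iff] at hx ⊢
    intro v
    by_cases hv : v = Sum.inr w.1
    · subst hv; rw [hrelax]; trivial
    · rw [← heq v hv]; exact hx v
  have h := card_selmerGroup_mul_eq_of_relax_at T inv hperf hsum hM h𝓕 h𝓖 w heq hstrict hrelax hii
  rw [hFd, hGd] at h
  -- `#H¹_𝓕 · [H¹_𝓖 : H¹_𝓕] = #H¹_𝓖` (no finiteness of the ambient group needed)
  have hidx : Nat.card 𝓕.selmerGroup * 𝓕.selmerGroup.relIndex 𝓖.selmerGroup = Nat.card 𝓖.selmerGroup := by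
    rw [← Nat.card_congr (AddSubgroup.addSubgroupOfEquivOfLe hle).toEquiv]
    exact AddSubgroup.card_mul_index _
  have hpos : 0 < Nat.card 𝓕.selmerGroup * Nat.card 𝓕.selmerGroup := Nat.mul_pos Nat.card_pos Nat.card_pos
  refine Nat.eq_of_mul_eq_mul_left hpos ?_
  calc Nat.card 𝓕.selmerGroup * Nat.card 𝓕.selmerGroup * (𝓕.selmerGroup.relIndex 𝓖.selmerGroup) ^ 2
      = (Nat.card 𝓕.selmerGroup * 𝓕.selmerGroup.relIndex 𝓖.selmerGroup) *
          (Nat.card 𝓕.selmerGroup * 𝓕.selmerGroup.relIndex 𝓖.selmerGroup) := by ring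
    _ = Nat.card 𝓖.selmerGroup * Nat.card 𝓖.selmerGroup := by rw [hidx]
    _ = Nat.card 𝓕.selmerGroup * Nat.card 𝓕.selmerGroup *
          Nat.card (galoisCohomology (ρ.toLocal (Sum.inr w.1)) 1) := h

/-! ## §3 (J) assembled -/

/-- **(J) — the image at `w` of the `w`-relaxed Selmer group of a numerically self-dual structure is not contained in a
line**, whenever `n² < #H¹(K_w, M)`: for every `x₀ ∈ H¹(K, M)` some `x ∈ H¹_𝓖(K, M)` satisfies `x − a • x₀ ∉ ker loc_w`
for all `a : ℤ`. Twin of part XI's `exists_forall_sub_zsmul_not_mem_ker_localization` with Howard's inclusion (ii) asked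
for this pair only (`hii`). [cite: McCallumLMS1991, Prop. 2.1 (p. 296)] [cite: WZhang2014, Lemma 8.2]
[cite: MilneADT2006, Ch. I, Thm. 4.10] -/
theorem exists_forall_sub_zsmul_not_mem_ker_localization_at [NeZero n] (hperf : inv.IsPerfect)
    (hsum : inv.SumLocalTermEqZero) (hM : ∀ m : M, n • m = 0)
    {𝓕 𝓖 : SelmerStructure ρ} (h𝓕 : 𝓕.IsUnramifiedOutside (finSupport T))
    (h𝓖 : 𝓖.IsUnramifiedOutside (finSupport T)) (w : T)
    (heq : ∀ v : Place K, v ≠ Sum.inr w.1 → 𝓕 v = 𝓖 v)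
    (hstrict : 𝓕 (Sum.inr w.1) = ⊥) (hrelax : 𝓖 (Sum.inr w.1) = ⊤) (hfin : Finite 𝓕.selmerGroup)
    (hFd : Nat.card (inv.dualSelmerStructure ρ 𝓕).selmerGroup = Nat.card 𝓖.selmerGroup)
    (hGd : Nat.card (inv.dualSelmerStructure ρ 𝓖).selmerGroup = Nat.card 𝓕.selmerGroup)
    (hw : n ^ 2 < Nat.card (galoisCohomology (ρ.toLocal (Sum.inr w.1)) 1))
    (hii : ∀ u : Π v : Place K, galoisCohomology ((ρ.tateDual n).toLocal v) 1,
      (∀ v ∈ finSupport T, u v ∈ inv.dualSelmerStructure ρ 𝓕 v) →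
      (∀ x ∈ 𝓖.selmerGroup,
        ∑ v ∈ finSupport T, localTatePairingZMod ρ n v (inv v)
          (galoisCohomology.localization ρ v 1 x) (u v) = 0) →
      ∃ y ∈ (inv.dualSelmerStructure ρ 𝓕).selmerGroup,
        ∀ v ∈ finSupport T, galoisCohomology.localization (ρ.tateDual n) v 1 y - u v ∈
          inv.dualSelmerStructure ρ 𝓖 v)
    (x₀ : galoisCohomology ρ 1) :
    ∃ x ∈ 𝓖.selmerGroup, ∀ a : ℤ,
      x - a • x₀ ∉ (galoisCohomology.localization ρ (Sum.inr w.1) 1).ker := by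
  haveI : Finite (galoisCohomology (ρ.toLocal (Sum.inr w.1)) 1) := finite_galoisCohomology_one_toLocal ρ w.1
  set f := galoisCohomology.localization ρ (Sum.inr w.1) 1 with hf
  -- `H¹_𝓕 = H¹_𝓖 ∩ ker loc_w`
  have hFG : 𝓕.selmerGroup = 𝓖.selmerGroup ⊓ f.ker := by
    ext x
    rw [AddSubgroup.mem_inf, SelmerStructure.mem_selmerGroup_iff, SelmerStructure.mem_selmerGroup_iff,
      AddMonoidHom.mem_ker]
    constructor
    · intro hx
      refine ⟨fun v ↦ ?_, ?_⟩
      · by_cases hv : v = Sum.inr w.1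
        · subst hv; rw [hrelax]; trivial
        · rw [← heq v hv]; exact hx v
      · have h := hx (Sum.inr w.1)
        rw [hstrict] at h
        exact (AddSubgroup.mem_bot).mp h
    · rintro ⟨hx, hx0⟩ v
      by_cases hv : v = Sum.inr w.1
      · subst hv; rw [hstrict]; exact (AddSubgroup.mem_bot).mpr hx0
      · rw [heq v hv]; exact hx v
  -- the index of the relaxation is `> n`
  have hsq := relIndex_sq_eq_of_selfdual_at T inv hperf hsum hM h𝓕 h𝓖 w heq hstrict hrelax hfin hFd hGd hii
  have hidx : n < 𝓕.selmerGroup.relIndex 𝓖.selmerGroup := by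
    by_contra! hle
    have := Nat.pow_le_pow_left hle 2
    rw [hsq] at this
    exact absurd hw (not_lt.mpr this)
  -- `#f(H¹_𝓖) = [H¹_𝓖 : H¹_𝓖 ∩ ker f]`
  have hcard : Nat.card (𝓖.selmerGroup.map f) = 𝓕.selmerGroup.relIndex 𝓖.selmerGroup := by
    rw [hFG, AddSubgroup.inf_relIndex_left, AddSubgroup.relIndex_ker]
  have hA : ∀ y : galoisCohomology (ρ.toLocal (Sum.inr w.1)) 1, n • y = 0 :=
    fun y ↦ nsmul_continuousCohomology_one_eq_zero _ n hM y
  exact exists_forall_sub_zsmul_not_mem_ker f (NeZero.ne n) hA 𝓖.selmerGroup (by rw [hcard]; exact hidx) x₀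

end General

/-! ## §4 (J) for `E[n]` modulo the Lagrangian property -/

section Weil

variable {K : Type u} [Field K] [NumberField K] (W : WeierstrassCurve K) (n : ℕ) [NeZero n] [W.IsElliptic]
variable (e : W.geomTorsion n → W.geomTorsion n → AlgebraicClosure K)
  (hμ : ∀ S T, e S T ^ n = 1)
  (hadd₁ : ∀ S₁ S₂ T, e (S₁ + S₂) T = e S₁ T * e S₂ T)
  (hadd₂ : ∀ S T₁ T₂, e S (T₁ + T₂) = e S T₁ * e S T₂)
  (hgal : ∀ (σ : Field.absoluteGaloisGroup K) (S T : W.geomTorsion n), σ • e S T = e (σ • S) (σ • T))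
  (hnondeg : ∀ T, (∀ S, e S T = 1) → T = 0)
  (inv : LocalInvariants K n)

include hnondeg in
/-- **(J) — the unsigned jump for `E[n]` from LAGRANGIAN local conditions**, with Howard's inclusion (ii) asked for the
pair `𝓕 ≤ 𝓖` at `S(T)` only (`hii`): `𝓕 ≤ 𝓖` Selmer structures on `E[n]` unramified outside `S(T)`, equal off the finite
place `w ∈ T`, `𝓕_w = 0`, `𝓖_w = H¹(K_w, E[n])`, the common condition at every place `v ≠ w` LAGRANGIAN for
`inv_v(· ∪ₑ ·)` (`hmax`), `H¹_𝓕` finite, `n² < #H¹(K_w, E[n])`. Then for every `x₀` some `x ∈ H¹_𝓖` has `x − a • x₀ ∉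
ker loc_w` for all `a : ℤ`. Twin of part XII's `exists_forall_sub_zsmul_not_mem_ker_localization_of_lagrangian` (its proof
of the two self-duality counts by the Weil transport is reused verbatim). [cite: McCallumLMS1991, Prop. 2.1 (p. 296)]
[cite: WZhang2014, Lemma 8.2] [cite: MilneADT2006, Ch. I, Thm. 4.10] -/
theorem exists_forall_sub_zsmul_not_mem_ker_localization_of_lagrangian_at [Finite (W.geomTorsion n)]
    (hperf : inv.IsPerfect) (hsum : inv.SumLocalTermEqZero)
    (T : Finset (HeightOneSpectrum (𝓞 K)))
    {𝓕 𝓖 : SelmerStructure (W.torsionGaloisModule n)} (h𝓕 : 𝓕.IsUnramifiedOutside (finSupport T))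
    (h𝓖 : 𝓖.IsUnramifiedOutside (finSupport T)) (w : T)
    (heq : ∀ v : Place K, v ≠ Sum.inr w.1 → 𝓕 v = 𝓖 v)
    (hstrict : 𝓕 (Sum.inr w.1) = ⊥) (hrelax : 𝓖 (Sum.inr w.1) = ⊤) (hfin : Finite 𝓕.selmerGroup)
    (hmax : ∀ v : Place K, v ≠ Sum.inr w.1 →
      annRight (invWeilPairing W n e hμ hadd₁ hadd₂ hgal inv v) (𝓕 v) = 𝓕 v)
    (hw : n ^ 2 < Nat.card (galoisCohomology ((W.torsionGaloisModule n).toLocal (Sum.inr w.1)) 1))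
    (hii : ∀ u : Π v : Place K, galoisCohomology (((W.torsionGaloisModule n).tateDual n).toLocal v) 1,
      (∀ v ∈ finSupport T, u v ∈ inv.dualSelmerStructure (W.torsionGaloisModule n) 𝓕 v) →
      (∀ x ∈ 𝓖.selmerGroup,
        ∑ v ∈ finSupport T, localTatePairingZMod (W.torsionGaloisModule n) n v (inv v)
          (galoisCohomology.localization (W.torsionGaloisModule n) v 1 x) (u v) = 0) →
      ∃ y ∈ (inv.dualSelmerStructure (W.torsionGaloisModule n) 𝓕).selmerGroup,
        ∀ v ∈ finSupport T, galoisCohomology.localization ((W.torsionGaloisModule n).tateDual n) v 1 y - u v ∈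
          inv.dualSelmerStructure (W.torsionGaloisModule n) 𝓖 v)
    (x₀ : galoisCohomology (W.torsionGaloisModule n) 1) :
    ∃ x ∈ 𝓖.selmerGroup, ∀ a : ℤ,
      x - a • x₀ ∉ (galoisCohomology.localization (W.torsionGaloisModule n) (Sum.inr w.1) 1).ker := by
  have hM : ∀ m : W.geomTorsion n, n • m = 0 := fun m ↦ AddSubgroup.torsionBy.nsmul m
  -- `#H¹_{𝓕*} = #H¹_𝓖`
  have hFd : Nat.card (inv.dualSelmerStructure (W.torsionGaloisModule n) 𝓕).selmerGroup =
      Nat.card 𝓖.selmerGroup := by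
    refine card_dualSelmerGroup_eq_of_weilTransport W n e hμ hadd₁ hadd₂ hgal hnondeg inv 𝓕 𝓖
      (fun v b hb ↦ ?_) (fun v a ha ↦ ?_)
    · by_cases hv : v = Sum.inr w.1
      · subst hv; rw [hrelax]; exact AddSubgroup.mem_top _
      · rw [← heq v hv]
        exact map_weilDualInv_mem_of_mem_dual_of_lagrangian W n e hμ hadd₁ hadd₂ hgal hnondeg inv v _ (hmax v hv) hb
    · by_cases hv : v = Sum.inr w.1
      · subst hv
        rw [hstrict, dualLocalCondition_bot_eq_top]
        exact AddSubgroup.mem_top _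
      · rw [← heq v hv] at ha
        exact map_weilDual_mem_dual_of_lagrangian W n e hμ hadd₁ hadd₂ hgal inv v _ (hmax v hv) ha
  -- `#H¹_{𝓖*} = #H¹_𝓕`
  have hGd : Nat.card (inv.dualSelmerStructure (W.torsionGaloisModule n) 𝓖).selmerGroup =
      Nat.card 𝓕.selmerGroup := by
    refine card_dualSelmerGroup_eq_of_weilTransport W n e hμ hadd₁ hadd₂ hgal hnondeg inv 𝓖 𝓕
      (fun v b hb ↦ ?_) (fun v a ha ↦ ?_)
    · by_cases hv : v = Sum.inr w.1
      · subst hv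
        rw [hrelax, dualLocalCondition_top_eq_bot (W.torsionGaloisModule n) inv hperf hM w.1] at hb
        have hb0 : b = 0 := (AddSubgroup.mem_bot).mp hb
        subst hb0
        exact (map_zero (galoisCohomology.map ((weilDualInv W n e hμ hadd₁ hadd₂ hgal hnondeg).restrictField
          (Place.Completion (Sum.inr w.1 : Place K))) 1)).symm ▸ AddSubgroup.zero_mem _
      · rw [← heq v hv] at hb
        exact map_weilDualInv_mem_of_mem_dual_of_lagrangian W n e hμ hadd₁ hadd₂ hgal hnondeg inv v _ (hmax v hv) hb
    · by_cases hv : v = Sum.inr w.1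
      · subst hv
        rw [hstrict] at ha
        have ha0 : a = 0 := (AddSubgroup.mem_bot).mp ha
        subst ha0
        exact (map_zero (galoisCohomology.map ((weilDualIntertwining W n e hμ hadd₁ hadd₂ hgal).restrictField
          (Place.Completion (Sum.inr w.1 : Place K))) 1)).symm ▸ AddSubgroup.zero_mem _
      · rw [← heq v hv]
        exact map_weilDual_mem_dual_of_lagrangian W n e hμ hadd₁ hadd₂ hgal inv v _ (hmax v hv) ha
  exact exists_forall_sub_zsmul_not_mem_ker_localization_at T inv hperf hsum hM h𝓕 h𝓖 w heq hstrict hrelax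
    hfin hFd hGd hw hii x₀

end Weil

/-! ## §5 The binder `hjump` at `(n, ℓ, T)` -/

section Jump

open WeierstrassCurve Literature.NumberTheory.EllipticCurves.ModularForms
open Summit.BirchSwinnertonDyer.Rank1Residual.X11b.Three.Koly.Method2

variable (W : WeierstrassCurve ℚ) (K : Type) [Field K] [NumberField K] [W.IsElliptic] [W.IsGloballyMinimal]
  (ι : K →+* ℂ)

/-- **`hjump` at `(n, ℓ, T)` END-TO-END from a perfect family with the Poitou–Tate vanishing + Weil + LAGRANGIAN
conditions + Howard's inclusion (ii) FOR THE PAIR `𝓕 ≤ 𝓖` at `S(T′)` (`hii`)** — twin of part XIV's `hjump_of_lagrangian`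
with the ∀-module `SelmerComplement` replaced by that single instance (§4 composed with part XIV's
`hjump_of_selmerStructure`; the admissibility hypothesis `hS` on `T′` is no longer needed; the finiteness of `E[3](K̄)`,
a `haveI` inside part XIV, is a binder here because `hii` mentions the dual structures). [cite: WZhang2014, Lemma 8.2]
[cite: McCallumLMS1991, Prop. 2.1 (p. 296)] [cite: MilneADT2006, Ch. I, Thm. 4.10] -/
theorem hjump_of_lagrangian_at
    (plK : {ℓ // Zhang2014.IsKolyvaginPrime (W.conductorNorm ℤ) W K 3 ℓ} → HeightOneSpectrum (𝓞 K))
    (n : Finset {q // IsUAdmissiblePrime W K q}) (ℓ : {ℓ // Zhang2014.IsKolyvaginPrime (W.conductorNorm ℤ) W K 3 ℓ})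
    (T : Finset {ℓ // Zhang2014.IsKolyvaginPrime (W.conductorNorm ℤ) W K 3 ℓ})
    -- a Weil pairing on `E[3]` and a perfect family with the Poitou–Tate vanishing at level `3`
    (e : (W.baseChange K).geomTorsion (3 ^ 1 : ℕ) → (W.baseChange K).geomTorsion (3 ^ 1 : ℕ) → AlgebraicClosure K)
    (hμ : ∀ S T, e S T ^ (3 ^ 1 : ℕ) = 1)
    (hadd₁ : ∀ S₁ S₂ T, e (S₁ + S₂) T = e S₁ T * e S₂ T)
    (hadd₂ : ∀ S T₁ T₂, e S (T₁ + T₂) = e S T₁ * e S T₂)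
    (hgal : ∀ (σ : Field.absoluteGaloisGroup K) (S T : (W.baseChange K).geomTorsion (3 ^ 1 : ℕ)),
      σ • e S T = e (σ • S) (σ • T))
    (hnondeg : ∀ T, (∀ S, e S T = 1) → T = 0)
    (inv : LocalInvariants K (3 ^ 1 : ℕ)) (hperf : inv.IsPerfect) (hsum : inv.SumLocalTermEqZero)
    [Finite ((W.baseChange K).geomTorsion ((3 ^ 1 : ℕ) : ℤ))]
    -- the support and the two structures
    (T' : Finset (HeightOneSpectrum (𝓞 K)))
    {𝓕 𝓖 : SelmerStructure ((W.baseChange K).torsionGaloisModule ((3 ^ 1 : ℕ) : ℤ))}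
    (h𝓕 : 𝓕.IsUnramifiedOutside (finSupport T')) (h𝓖 : 𝓖.IsUnramifiedOutside (finSupport T'))
    (w : T') (hwℓ : (w : HeightOneSpectrum (𝓞 K)) = plK ℓ)
    (heq : ∀ v : Place K, v ≠ Sum.inr w.1 → 𝓕 v = 𝓖 v)
    (hstrict : 𝓕 (Sum.inr w.1) = ⊥) (hrelax : 𝓖 (Sum.inr w.1) = ⊤) (hfin : Finite 𝓕.selmerGroup)
    (hmax : ∀ v : Place K, v ≠ Sum.inr w.1 →
      annRight (invWeilPairing (W.baseChange K) (3 ^ 1 : ℕ) e hμ hadd₁ hadd₂ hgal inv v) (𝓕 v) = 𝓕 v)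
    (hw : (3 ^ 1 : ℕ) ^ 2 <
      Nat.card (galoisCohomology (((W.baseChange K).torsionGaloisModule ((3 ^ 1 : ℕ) : ℤ)).toLocal (Sum.inr w.1)) 1))
    -- Howard's inclusion (ii) for THIS pair at `S(T′)`
    (hii : ∀ u : Π v : Place K,
        galoisCohomology ((((W.baseChange K).torsionGaloisModule ((3 ^ 1 : ℕ) : ℤ)).tateDual (3 ^ 1 : ℕ)).toLocal v) 1,
      (∀ v ∈ finSupport T', u v ∈ inv.dualSelmerStructure ((W.baseChange K).torsionGaloisModule ((3 ^ 1 : ℕ) : ℤ)) 𝓕 v) →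
      (∀ x ∈ 𝓖.selmerGroup,
        ∑ v ∈ finSupport T', localTatePairingZMod ((W.baseChange K).torsionGaloisModule ((3 ^ 1 : ℕ) : ℤ)) (3 ^ 1 : ℕ)
          v (inv v) (galoisCohomology.localization ((W.baseChange K).torsionGaloisModule ((3 ^ 1 : ℕ) : ℤ)) v 1 x)
          (u v) = 0) →
      ∃ y ∈ (inv.dualSelmerStructure ((W.baseChange K).torsionGaloisModule ((3 ^ 1 : ℕ) : ℤ)) 𝓕).selmerGroup,
        ∀ v ∈ finSupport T',
          galoisCohomology.localization (((W.baseChange K).torsionGaloisModule ((3 ^ 1 : ℕ) : ℤ)).tateDual (3 ^ 1 : ℕ))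
            v 1 y - u v ∈ inv.dualSelmerStructure ((W.baseChange K).torsionGaloisModule ((3 ^ 1 : ℕ) : ℤ)) 𝓖 v)
    -- the dictionary: the Selmer group of `𝓖` lies in the relaxed group `G(n, ℓ, T)`
    (hincl : ∀ x ∈ 𝓖.selmerGroup,
      (∀ w : InfinitePlace K, x ∈ selmerLocalKer (W.baseChange K) w.Completion ((3 ^ 1 : ℕ) : ℤ)) ∧
        (∀ v : HeightOneSpectrum (𝓞 K), v ≠ plK ℓ → (∀ ℓ' ∈ T, plK ℓ' ≠ v) →
          ((∀ q ∈ n, ((q : ℕ) : 𝓞 K) ∉ v.asIdeal) →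
            x ∈ selmerLocalKer (W.baseChange K) (v.adicCompletion K) ((3 ^ 1 : ℕ) : ℤ)) ∧
          (∀ q ∈ n, ((q : ℕ) : 𝓞 K) ∈ v.asIdeal →
            x ∈ (W.baseChange K).ordinaryLocalKer (v.adicCompletion K) ((3 ^ 1 : ℕ) : ℤ))) ∧
        (∀ ℓ' ∈ T, x ∈ transverseLocalKer W K ι ℓ' (plK ℓ'))) :
    ∀ x₀ : V3 W K, ∃ x : V3 W K,
      ((∀ w : InfinitePlace K, x ∈ selmerLocalKer (W.baseChange K) w.Completion ((3 ^ 1 : ℕ) : ℤ)) ∧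
        (∀ v : HeightOneSpectrum (𝓞 K), v ≠ plK ℓ → (∀ ℓ' ∈ T, plK ℓ' ≠ v) →
          ((∀ q ∈ n, ((q : ℕ) : 𝓞 K) ∉ v.asIdeal) →
            x ∈ selmerLocalKer (W.baseChange K) (v.adicCompletion K) ((3 ^ 1 : ℕ) : ℤ)) ∧
          (∀ q ∈ n, ((q : ℕ) : 𝓞 K) ∈ v.asIdeal →
            x ∈ (W.baseChange K).ordinaryLocalKer (v.adicCompletion K) ((3 ^ 1 : ℕ) : ℤ))) ∧
        (∀ ℓ' ∈ T, x ∈ transverseLocalKer W K ι ℓ' (plK ℓ'))) ∧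
      ∀ a : ℤ, x - a • x₀ ∉ (W.baseChange K).torsionLocalKer ((plK ℓ).adicCompletion K) ((3 ^ 1 : ℕ) : ℤ) := by
  refine hjump_of_selmerStructure W K ι plK n ℓ T 𝓖 hincl fun x₀ ↦ ?_
  obtain ⟨x, hx, hxa⟩ := exists_forall_sub_zsmul_not_mem_ker_localization_of_lagrangian_at (W.baseChange K)
    (3 ^ 1 : ℕ) e hμ hadd₁ hadd₂ hgal hnondeg inv hperf hsum T' h𝓕 h𝓖 w heq hstrict hrelax hfin hmax hw hii x₀
  refine ⟨x, hx, fun a ↦ ?_⟩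
  rw [← hwℓ]
  exact hxa a

end Jump

end Summit.BirchSwinnertonDyer.Rank1Residual.X11b.Three.Koly.PTAt

end
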